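import Literature.AlgebraicGeometry.Frobenioids.ArithmeticFrobenioidThm64iVariants
import Literature.AlgebraicGeometry.Frobenioids.ArithmeticFrobenioidFrobeniusCompact
import Literature.AlgebraicGeometry.Frobenioids.ArithmeticDivisorsPrimes
import Literature.AlgebraicGeometry.Frobenioids.RlfPrimes
import HarnessLib

/-!
# Frobenioids I, Proposition 5.5 (iii), "Finally", rationally standard — the slot `Prop55iii_untr_rlf_ratStd`
# is NOT closable AS TYPED (GAP P55iii-F1 of the cell, now a kernel counterexample)

Mochizuki, *The geometry of Frobenioids I: the general theory*, Kyushu J. Math. **62** (2008)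
293–400, §5, Proposition 5.5 (iii) p. 104 ll. 37–39; Def. 4.5 (ii)/(iii) p. 86 (strictly rational: "for every
prime `𝔭` there is `a − b ∈ Φ^birat` with `𝔭 ∈ Supp(a)`, `𝔭 ∉ Supp(b)`"); Example 6.3 / Theorem 6.4 (i)
pp. 113–115 (the arithmetic Frobenioid `C_{K/F}`). [cite: MochizukiFrdI2008, Prop. 5.5 (iii) p.104]

REFUTATION-AS-TYPED companion (cell abc-iut, layer L1, node `FrdI:Prop5.5(iii)`, sub-DAG row
`FrdI:Prop5.5(iii)/P55-L07`, GAP row P55iii-F1; seat abc-iut-w5-d250). The statements file `Prop55Sub.lean`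
(seat abc-iut-w4-d084) types the rationally-standard "Finally" clause as
`FrdI.Prop55Sub.Prop55iii_untr_rlf_ratStd F hF hΦ Supp SuppR`, where the support predicate `SuppR` on the REALIFIED
divisor monoids `Φ^rlf` is a FREE binder, unrelated to `Supp`. A universal closer would have to serve every
`SuppR`, in particular `SuppR := fun _ _ => False`, for which "strictly rational" (Def. 4.5 (ii)) at an object over
`X` says that `Φ^rlf(X)` has NO primes; so the `C^rlf` conjunct fails as soon as the antecedents are met by some
Frobenioid all of whose realified divisor monoids have a prime. Witness: the arithmetic Frobenioid `C_{K/F}` of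
Example 6.3 (all antecedents are theorems of the cell: Frobenius-isotropic, Frobenius-normalized, not group-like,
of rationally standard type at THE support — seats abc-iut-w4-d086 / L6-t10), whose `Φ^rlf(Spec L)` has the
prime attached to any archimedean place of `L` (`Prime(Φ(L)) ≅ V(L)`, Ex. 6.3; `Prime(M^rlf) ≅ Prime(M^pf) ≅
Prime(M)`, Def. 2.4 (i)(c), seat abc-iut-L1-d2):
* `FrdI.Prop55Sub.not_prop55iii_untr_rlf_ratStd_arith` — `¬ Prop55iii_untr_rlf_ratStd (C_{K/F}) hF hΦ PrimarySupp ⊥`;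
* `FrdI.Prop55Sub.not_prop55iii_pf_ratStd_arith` — the TWIN for the perfection slot `Prop55iii_pf_ratStd F hF Supp SuppPf`
  (free support `SuppPf` on `Φ^pf`; seat abc-iut-w4-d108 closes it AT THE CANONICAL SUPPORT instead):
  `¬ Prop55iii_pf_ratStd (C_{K/F}) hF PrimarySupp ⊥`, since every `Φ(L)^pf` has a prime (`Prime(M^pf) ≅ Prime(M)`).
The REPAIRED slot `Prop55iii_untr_rlf_ratStd'` (THE support `PrimarySupp` on both sides; `Prop55SubRatStdSlot.lean`)
is PROVED (`prop55iii_untr_rlf_ratStd'_holds`, `Prop55SubRatStdRlfHolds.lean`). Classification: MISSTATED (free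
support binder), not a defect of the printed proposition. Nothing here bears on [IUTchIII] Cor. 3.12.
-/

noncomputable section

namespace Literature.AlgebraicGeometry.Frobenioids

open CategoryTheory Opposite
open PreFrobenioid
open PreFrobenioidData (ofFunctor)

namespace FrdI.Prop55Sub

variable (F : Type) [Field F] [NumberField F] (K : Type) [Field K] [Algebra F K] [IsGalois F K]

/-- **The slot `Prop55iii_untr_rlf_ratStd` is false AS TYPED** at the arithmetic Frobenioid `C_{K/F}` of [FrdI]
Ex. 6.3 with `Supp := PrimarySupp` (THE support) and the admissible-but-degenerate `SuppR := ⊥` on `Φ^rlf`: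
the antecedents hold (Frobenius-isotropic, Frobenius-normalized, not group-like, rationally standard — seats
abc-iut-w4-d086 / L6-t10), but no object of `C_{K/F}^rlf` is rational for `SuppR = ⊥`, since every
`Φ^rlf(Spec L)` has a prime (the one of an archimedean place of the number field `L`). GAP P55iii-F1; the
repaired slot `Prop55iii_untr_rlf_ratStd'` is proved elsewhere. [cite: MochizukiFrdI2008, Prop. 5.5 (iii) p.104] -/
theorem not_prop55iii_untr_rlf_ratStd_arith :
    ¬ Prop55iii_untr_rlf_ratStd
        (ModelFrobenioid.toElem (arithDivisorFunctor F K) (unitsFunctor F K) (divNatTrans F K))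
        (arithFrobenioid_isFrobenioid F K) (arith_isPerfFactorialOn F K)
        (fun a 𝔭 => PrimarySupp a 𝔭) (fun _ _ => False) := by
  intro h
  obtain ⟨-, hrlf⟩ := h (arith_isOfType_isFrobeniusIsotropic F K) (arith_isOfType_isFrobeniusNormalized F K)
    (arith_not_isOfType_isGroupLikeObj F K) (arithFrobenioid_isOfRationallyStandardType_rsParams F K)
  -- the object `(Spec ⊥, 0)` of `C_{K/F}^rlf` would be rational for the empty support predicate
  let M : rlf (ModelFrobenioid.toElem (arithDivisorFunctor F K) (unitsFunctor F K) (divNatTrans F K))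
      (arith_isPerfFactorialOn F K) := ⟨⟨⊥⟩, 1⟩
  obtain ⟨W, φ, -, hsr⟩ := (hrlf (arith_rlf_isFrobenioid F K)).rational M
  -- a prime of `Φ^rlf(Base W)`: the one attached to an archimedean place of the number field `L = (Base W).L`
  obtain ⟨w⟩ := (inferInstance : Nonempty (NumberField.InfinitePlace W.base.L))
  have hM : IsPerfFactorial (Multiplicative (EffArithDivisor W.base.L)) :=
    IsPerfFactorialOn.op (arith_isPerfFactorialOn F K) (op W.base)
  let 𝔭₀ : Primes (Multiplicative (EffArithDivisor W.base.L)) :=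
    Quotient.mk (primarySetoid _) ⟨_, EffArithDivisor.isPrimary_single (Sum.inl w)⟩
  let P : Primes hM.Rlf :=
    IsPerfFactorial.Rlf.primeOf hM (Primes.perfectionEquiv hM.isDivisorial.isSharp 𝔭₀)
  obtain ⟨_, _, -, hfalse, -⟩ := hsr P
  exact hfalse

/-- **The twin: the slot `Prop55iii_pf_ratStd` is false AS TYPED** at `C_{K/F}` with `Supp := PrimarySupp` and the
degenerate free support `SuppPf := ⊥` on `Φ^pf`: the antecedents hold (Frobenius-isotropic, Frobenius-normalized,
`C^pf` a Frobenioid — seat abc-iut-w4-d086's `arith_pf_isFrobenioid` —, `C` rationally standard), but no object of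
`C_{K/F}^pf` is rational for `SuppPf = ⊥`, every `Φ(Spec L)^pf` having a prime (`Prime(M^pf) ≅ Prime(M) ≅ V(L) ≠ ∅`).
Seat abc-iut-w4-d108's closers at the canonical support `PrimarySupp` are the repaired form.
[cite: MochizukiFrdI2008, Prop. 5.5 (iii) p.104] -/
theorem not_prop55iii_pf_ratStd_arith :
    ¬ Prop55iii_pf_ratStd
        (ModelFrobenioid.toElem (arithDivisorFunctor F K) (unitsFunctor F K) (divNatTrans F K))
        (arithFrobenioid_isFrobenioid F K) (fun a 𝔭 => PrimarySupp a 𝔭) (fun _ _ => False) := by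
  intro h
  have hpf := h (arith_isOfType_isFrobeniusIsotropic F K) (arith_isOfType_isFrobeniusNormalized F K)
    (arith_pf_isFrobenioid F K) (arithFrobenioid_isOfRationallyStandardType_rsParams F K)
  -- the object `((Spec ⊥, 0), 1)` of `C_{K/F}^pf` would be rational for the empty support predicate
  obtain ⟨W, φ, -, hsr⟩ := hpf.rational
    ((Perfection.toPf (arithFrobenioid_isFrobenioid F K)).obj (⟨⟨⊥⟩, 1⟩ : arithFrobenioid F K))
  -- a prime of `Φ(Base W)^pf`: the one attached to an archimedean place of the number field `(Base W).L`
  obtain ⟨w⟩ := (inferInstance : Nonempty (NumberField.InfinitePlace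
    ((Perfection.ops (arithFrobenioid_isFrobenioid F K)).base.obj W).L))
  have hM : IsPerfFactorial (Multiplicative (EffArithDivisor
      ((Perfection.ops (arithFrobenioid_isFrobenioid F K)).base.obj W).L)) :=
    IsPerfFactorialOn.op (arith_isPerfFactorialOn F K) (op _)
  let 𝔭₀ : Primes (Multiplicative (EffArithDivisor
      ((Perfection.ops (arithFrobenioid_isFrobenioid F K)).base.obj W).L)) :=
    Quotient.mk (primarySetoid _) ⟨_, EffArithDivisor.isPrimary_single (Sum.inl w)⟩
  obtain ⟨_, _, -, hfalse, -⟩ := hsr (Primes.perfectionEquiv hM.isDivisorial.isSharp 𝔭₀)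
  exact hfalse

end FrdI.Prop55Sub

end Literature.AlgebraicGeometry.Frobenioids

end
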